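import Mathlib
import Summits.Ventures.PercRepro.PuncturedLYMMixT1Q2Table1

/-!
# PercRepro — (SP) FOR `1` PAIRWISE DISJOINT TRIPLES AND `2` PAIRWISE DISJOINT QUADRUPLES AT LEVEL `4`: POSITIVITY OF THE DENOMINATORS (1)
(p10, gen 41)

`den > 0`, `Pc > 0` for `n ≥ 11`; `Yc > 0` for `n ≥ 5`.  Nothing here asserts (SP).
-/

namespace PercRepro.PuncturedLYM.Split.TypeLift.MixT1Q2

/-- `den > 0` for `n ≥ 11`. -/
theorem den_pos (n : ℚ) (hn : 11 ≤ n) : 0 < den n := by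
  obtain ⟨n', hn', rfl⟩ : ∃ n', 0 ≤ n' ∧ n = 11 + n' := ⟨n - 11, by linarith, by ring⟩
  have h : den (11 + n') = 20736 * n' ^ 13 + 2547072 * n' ^ 12 + 144253008 * n' ^ 11 + 4986768960 * n' ^ 10 + 117381944628 * n' ^ 9 + 1986373321068 * n' ^ 8 + 24857347873056 * n' ^ 7 + 232861769021976 * n' ^ 6 + 1632706508041236 * n' ^ 5 + 8460645735574812 * n' ^ 4 + 31489195542999240 * n' ^ 3 + 79694161584094752 * n' ^ 2 + 122901051113074944 * n' + 87204773862899712 := by unfold den; ring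
  rw [h]; positivity

/-- `Yc > 0` for `n ≥ 5`. -/
theorem Yc_pos (n : ℚ) (hn : 5 ≤ n) : 0 < Yc n := by
  obtain ⟨n', hn', rfl⟩ : ∃ n', 0 ≤ n' ∧ n = 5 + n' := ⟨n - 5, by linarith, by ring⟩
  have h : Yc (5 + n') = (1 / 120) * n' ^ 5 + (1 / 8) * n' ^ 4 + (17 / 24) * n' ^ 3 + (15 / 8) * n' ^ 2 + (137 / 60) * n' + 1 := by unfold Yc; ring
  rw [h]; positivity

/-- `Pc > 0` for `n ≥ 11`. -/
theorem Pc_pos (n : ℚ) (hn : 11 ≤ n) : 0 < Pc n := by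
  obtain ⟨n', hn', rfl⟩ : ∃ n', 0 ≤ n' ∧ n = 11 + n' := ⟨n - 11, by linarith, by ring⟩
  have h : Pc (11 + n') = (1 / 24) * n' ^ 4 + (19 / 12) * n' ^ 3 + (539 / 24) * n' ^ 2 + (1679 / 12) * n' + 320 := by unfold Pc; ring
  rw [h]; positivity

end PercRepro.PuncturedLYM.Split.TypeLift.MixT1Q2
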